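import Summits.ABC.ABC.Theses.CongruentialReceptacle
import Summits.ABC.ABC.Theorems.CongruentialReceptacleAssembly
import HarnessLib

/-!
# Crux `BalancedFreySzpiro` (stmt-ABC-1723): the `ε` cannot be dropped on the compactly balanced cell

Tightness lemma for the crux of route CongruentialReceptacle (line SketchIdeator1, lead prover). The crux
asks, for every balance `κ > 0` and every `ε > 0`, for a constant `C` with
`(abc)² ≤ C · rad(abc)^(6+ε)` on all abc triples with `κc ≤ a`, `κc ≤ b`. We prove that its `ε = 0`
case is FALSE, already on each single balance window `κ < 1/2`:

* `exists_balanced_abc_triple_lt` — for every `κ < 1/2` and every real `K` there is an abc triple with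
  `κc ≤ a`, `κc ≤ b` and `c > K · rad(abc)`;
* `not_balancedSzpiro_epsilon_zero` — hence no `C` with `(abc)² ≤ C · rad(abc)^6` on the window `κ`
  (`0 < κ < 1/2`), and `balancedFreySzpiro_false_without_eps` — the crux with `ε := 0` fails.

The printed `ε = 0` counterexamples (Granville–Tucker, Stewart–Tijdeman, B–G 12.4.12; tree:
`Literature.Barriers.ABC.not_abc_epsilon_zero`, `exists_triple_polylog`) are all maximally UNbalanced
(`a = 1` or `a = o(c)`), so they say nothing on the cell (scope gap recorded in the barrier entry
`Literature.Barriers.ABC.EpsilonCannotBeDropped`).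

## Construction (balanced witnesses)

Fix `κ' = max(κ, 1/4) ∈ [1/4, 1/2)`, `α = −log(1−κ')`, `β = −log κ'`, so `0 < α < β`. Take `j ≥ 1` with
`5^j > 30K`, `M = 5^j`, `N = φ(M)`; by Euler `2^N ≡ 3^N ≡ 1 (mod M)`. By Dirichlet's approximation
theorem (`Real.exists_int_int_abs_mul_sub_le` with `ξ = log 2 / log 3`) there are positive integers
`k, m` with `0 < θ := |k log 2 − m log 3| ≤ (β − α)/N` (`θ ≠ 0` because `2^k` is even and `3^m` odd).
With `t = ⌈α/(Nθ)⌉` one has `tNθ ∈ [α, β)`. Put `X = 2^(kNt)`, `Y = 3^(mNt)`: then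
`|log Y − log X| = tNθ ∈ [α, β]`, `X ≡ Y ≡ 1 (mod 5^j)`. With `a = min(X,Y)`, `c = max(X,Y)`, `b = c − a`:
`(a, b, c)` is an abc triple (`gcd(a, b) = gcd(a, c) = 1`), `a/c = e^{−tNθ} ∈ [κ', 1−κ']` gives
`κ'c ≤ a` and `κ'c ≤ b`, and `5^j ∣ b` gives `rad(abc) ≤ 2·3·5·(b/5^j) < 30c/5^j < c/K`.
No prime number theorem and no geometry of numbers is needed; the price is the size of `c` (doubly
exponential in `j`), irrelevant for an `ε = 0` refutation. [new; cell analogue of B–G Prop. 12.4.12]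
-/

set_option linter.dupNamespace false

noncomputable section

open Literature.NumberTheory.DiophantineGeometry UniqueFactorizationMonoid
open Summit.ABC.ABC.Theses.CongruentialReceptacle

namespace Summit.ABC.ABC.Theorems.BalancedFreySzpiro.Negative

/-! ### Dirichlet step -/

/-- `log 2 / log 3 > 1/2` (i.e. `4 > 3`). [folklore] -/
theorem half_lt_log_two_div_log_three : (1 / 2 : ℝ) < Real.log 2 / Real.log 3 := by
  rw [lt_div_iff₀ (Real.log_pos (by norm_num))]
  have h4 : Real.log 4 = 2 * Real.log 2 := by
    rw [show (4 : ℝ) = 2 ^ 2 by norm_num, Real.log_pow]; norm_num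
  linarith [Real.log_lt_log (by norm_num : (0 : ℝ) < 3) (by norm_num : (3 : ℝ) < 4)]

/-- `2^k ≠ 3^m` for `k ≥ 1`, in logarithmic form: `k log 2 ≠ m log 3` for positive naturals `k, m`.
[folklore] -/
theorem nat_mul_log_two_ne_mul_log_three {k m : ℕ} (hk : 0 < k) :
    (k : ℝ) * Real.log 2 ≠ (m : ℝ) * Real.log 3 := by
  intro h
  rw [← Real.log_pow, ← Real.log_pow] at h
  have h2 : (0 : ℝ) < 2 ^ k := by positivity
  have h3 : (0 : ℝ) < 3 ^ m := by positivity
  have heq : ((2 : ℝ)) ^ k = (3 : ℝ) ^ m := Real.log_injOn_pos (Set.mem_Ioi.mpr h2) (Set.mem_Ioi.mpr h3) h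
  have heqN : (2 : ℕ) ^ k = 3 ^ m := by exact_mod_cast heq
  have h2dvd : 2 ∣ 3 ^ m := by
    rw [← heqN]; exact dvd_pow_self 2 hk.ne'
  have := Nat.Prime.dvd_of_dvd_pow Nat.prime_two h2dvd
  omega

/-- **Dirichlet step.** For every `δ > 0` there are positive naturals `k, m` with
`0 < |k log 2 − m log 3| ≤ δ` (Dirichlet's approximation theorem for `ξ = log 2 / log 3`; positivity of
`m` from `log 2 / log 3 > 1/2`; non-vanishing from parity). [folklore] -/
theorem exists_pos_nat_abs_log_two_three_le {δ : ℝ} (hδ : 0 < δ) :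
    ∃ k m : ℕ, 0 < k ∧ 0 < m ∧ 0 < |(k : ℝ) * Real.log 2 - (m : ℝ) * Real.log 3| ∧
      |(k : ℝ) * Real.log 2 - (m : ℝ) * Real.log 3| ≤ δ := by
  have h2 : 0 < Real.log 2 := Real.log_pos (by norm_num)
  have h3 : 0 < Real.log 3 := Real.log_pos (by norm_num)
  obtain ⟨n, hn⟩ := exists_nat_ge (Real.log 3 / δ)
  have hN : 0 < n + 1 := Nat.succ_pos n
  obtain ⟨j, k, hk0, _hkn, hjk⟩ := Real.exists_int_int_abs_mul_sub_le (Real.log 2 / Real.log 3) hN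
  -- the bound `|k log 2 - j log 3| ≤ log 3 / (n + 2) ≤ δ`
  have hscale : |(k : ℝ) * Real.log 2 - (j : ℝ) * Real.log 3| =
      |(k : ℝ) * (Real.log 2 / Real.log 3) - j| * Real.log 3 := by
    rw [← abs_of_pos h3, ← abs_mul, abs_of_pos h3]
    congr 1
    field_simp
  have hbound : |(k : ℝ) * Real.log 2 - (j : ℝ) * Real.log 3| ≤ δ := by
    rw [hscale]
    have hn1 : (0 : ℝ) < (n : ℝ) + 1 + 1 := by positivity
    calc |(k : ℝ) * (Real.log 2 / Real.log 3) - j| * Real.log 3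
        ≤ 1 / ((((n + 1 : ℕ) : ℝ)) + 1) * Real.log 3 := mul_le_mul_of_nonneg_right hjk h3.le
      _ ≤ δ := by
          push_cast
          rw [div_mul_eq_mul_div, one_mul, div_le_iff₀ hn1]
          have hδn : Real.log 3 ≤ δ * n := by rwa [div_le_iff₀ hδ, mul_comm] at hn
          nlinarith
  -- `j ≥ 1`
  have hk1 : (1 : ℝ) ≤ k := by exact_mod_cast hk0
  have hξ := half_lt_log_two_div_log_three
  have hjpos : (0 : ℝ) < j := by
    have h1 : (k : ℝ) * (Real.log 2 / Real.log 3) - j ≤ 1 / ((((n + 1 : ℕ) : ℝ)) + 1) :=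
      (le_abs_self _).trans hjk
    have h2' : 1 / ((((n + 1 : ℕ) : ℝ)) + 1) ≤ 1 / 2 :=
      one_div_le_one_div_of_le (by norm_num) (by push_cast; linarith [(Nat.cast_nonneg n : (0 : ℝ) ≤ n)])
    have h3' : Real.log 2 / Real.log 3 ≤ (k : ℝ) * (Real.log 2 / Real.log 3) :=
      le_mul_of_one_le_left (by positivity) hk1
    linarith
  have hj0 : 0 < j := by exact_mod_cast hjpos
  refine ⟨k.toNat, j.toNat, by omega, by omega, ?_, ?_⟩
  · have hkk : ((k.toNat : ℕ) : ℝ) = (k : ℝ) := by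
      rw [show (k.toNat : ℝ) = ((k.toNat : ℤ) : ℝ) from rfl, Int.toNat_of_nonneg hk0.le]
    exact abs_pos.mpr (sub_ne_zero.mpr (nat_mul_log_two_ne_mul_log_three (by omega)))
  · have hkk : ((k.toNat : ℕ) : ℝ) = (k : ℝ) := by
      have : ((k.toNat : ℤ) : ℝ) = (k : ℝ) := by rw [Int.toNat_of_nonneg hk0.le]
      exact_mod_cast this
    have hjj : ((j.toNat : ℕ) : ℝ) = (j : ℝ) := by
      have : ((j.toNat : ℤ) : ℝ) = (j : ℝ) := by rw [Int.toNat_of_nonneg hj0.le]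
      exact_mod_cast this
    rw [hkk, hjj]
    exact hbound

/-! ### The arithmetic core -/

/-- **Arithmetic core of the balanced witnesses.** If `p, q, r` are primes, `p ≠ q`, `p^x < q^y` and
`r^j ∣ q^y − p^x`, then `(p^x, q^y − p^x, q^y)` is an abc triple and
`rad · r^j ≤ p·q·r · (q^y − p^x)` (every prime of `p^x (q^y − p^x) q^y` is `p`, `q`, `r` or divides
`(q^y − p^x)/r^j`). [folklore] -/
theorem balancedWitness_core {p q r x y j : ℕ} (hp : p.Prime) (hq : q.Prime) (hr : r.Prime)
    (hpq : p ≠ q) (hlt : p ^ x < q ^ y) (hdvd : r ^ j ∣ q ^ y - p ^ x) :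
    IsABCTriple (p ^ x) (q ^ y - p ^ x) (q ^ y) ∧
      rad (p ^ x) (q ^ y - p ^ x) (q ^ y) * r ^ j ≤ p * q * r * (q ^ y - p ^ x) := by
  have hA : 0 < p ^ x := pow_pos hp.pos x
  have hB : 0 < q ^ y - p ^ x := Nat.sub_pos_of_lt hlt
  have hcopAC : Nat.Coprime (p ^ x) (q ^ y) := Nat.coprime_pow_primes x y hp hq hpq
  have hcop : Nat.Coprime (p ^ x) (q ^ y - p ^ x) :=
    (Nat.coprime_sub_self_right hlt.le).mpr hcopAC
  refine ⟨⟨hA, hB, Nat.add_sub_cancel' hlt.le, hcop⟩, ?_⟩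
  obtain ⟨B', hB'⟩ := hdvd
  have hB'0 : B' ≠ 0 := by
    rintro rfl
    rw [mul_zero] at hB'
    omega
  have hK : p * q * r * B' ≠ 0 :=
    Nat.mul_ne_zero (Nat.mul_ne_zero (Nat.mul_ne_zero hp.ne_zero hq.ne_zero) hr.ne_zero) hB'0
  have hraddvd : radical (p ^ x * (q ^ y - p ^ x) * q ^ y) ∣ p * q * r * B' := by
    rw [Nat.radical_dvd_iff hK]
    intro s hs
    rw [Nat.mem_primeFactors] at hs ⊢
    obtain ⟨hsprime, hsdvd, -⟩ := hs
    refine ⟨hsprime, ?_, hK⟩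
    rcases (Nat.Prime.dvd_mul hsprime).mp hsdvd with h | h
    · rcases (Nat.Prime.dvd_mul hsprime).mp h with h | h
      · have := (Nat.prime_dvd_prime_iff_eq hsprime hp).mp (hsprime.dvd_of_dvd_pow h)
        subst this
        exact Dvd.dvd.mul_right (Dvd.dvd.mul_right (dvd_mul_right s q) r) B'
      · rw [hB'] at h
        rcases (Nat.Prime.dvd_mul hsprime).mp h with h | h
        · have := (Nat.prime_dvd_prime_iff_eq hsprime hr).mp (hsprime.dvd_of_dvd_pow h)
          subst this
          exact Dvd.dvd.mul_right (dvd_mul_left s (p * q)) B'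
        · exact Dvd.dvd.mul_left h _
    · have := (Nat.prime_dvd_prime_iff_eq hsprime hq).mp (hsprime.dvd_of_dvd_pow h)
      subst this
      exact Dvd.dvd.mul_right (Dvd.dvd.mul_right (dvd_mul_left s p) r) B'
  have hle : radical (p ^ x * (q ^ y - p ^ x) * q ^ y) ≤ p * q * r * B' :=
    Nat.le_of_dvd (Nat.pos_of_ne_zero hK) hraddvd
  calc rad (p ^ x) (q ^ y - p ^ x) (q ^ y) * r ^ j
      = radical (p ^ x * (q ^ y - p ^ x) * q ^ y) * r ^ j := by rw [rad_def]
    _ ≤ p * q * r * B' * r ^ j := Nat.mul_le_mul_right _ hle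
    _ = p * q * r * (q ^ y - p ^ x) := by rw [hB']; ring

/-! ### Balance from logarithmic bounds -/

/-- If `0 < A`, `0 < C` and `−log(1−κ') ≤ log C − log A ≤ −log κ'` with `0 < κ' < 1`, then
`κ'C ≤ A` and `κ'C ≤ C − A`. [folklore] -/
theorem balanced_of_log_bounds {κ' A C : ℝ} (hκ'0 : 0 < κ') (hκ'1 : κ' < 1) (hA : 0 < A)
    (hC : 0 < C) (h1 : -Real.log (1 - κ') ≤ Real.log C - Real.log A)
    (h2 : Real.log C - Real.log A ≤ -Real.log κ') : κ' * C ≤ A ∧ κ' * C ≤ C - A := by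
  have h1κ : 0 < 1 - κ' := by linarith
  constructor
  · have h : Real.log (κ' * C) ≤ Real.log A := by
      rw [Real.log_mul hκ'0.ne' hC.ne']; linarith
    exact (Real.log_le_log_iff (mul_pos hκ'0 hC) hA).mp h
  · have h : Real.log A ≤ Real.log ((1 - κ') * C) := by
      rw [Real.log_mul h1κ.ne' hC.ne']; linarith
    have h' := (Real.log_le_log_iff hA (mul_pos h1κ hC)).mp h
    linarith

/-! ### The witnesses -/

/-- **`ε` cannot be dropped on the compactly balanced cell.** For every balance `κ < 1/2` and every
real `K` there is an abc triple `(a, b, c)` with `κc ≤ a`, `κc ≤ b` and `c > K · rad(abc)`.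
Construction: `a, c ∈ {2^(kNt), 3^(mNt)}` with `N = φ(5^j)`, `5^j > 30K`, `(k, m)` from Dirichlet's
approximation theorem so that `|log c − log a| ∈ [−log(1−κ'), −log κ']`, `κ' = max(κ, 1/4)`, and
`5^j ∣ b = c − a` (Euler), whence `rad(abc) ≤ 30 b / 5^j`. [new; cell analogue of
GranvilleTucker2002 p. 1227 / BombieriGubler2006 Prop. 12.4.12] -/
theorem exists_balanced_abc_triple_lt (κ K : ℝ) (hκ : κ < 1 / 2) :
    ∃ a b c : ℕ, IsABCTriple a b c ∧ κ * (c : ℝ) ≤ (a : ℝ) ∧ κ * (c : ℝ) ≤ (b : ℝ) ∧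
      K * ((rad a b c : ℕ) : ℝ) < (c : ℝ) := by
  -- the window `κ' = max κ (1/4)`
  set κ' : ℝ := max κ (1 / 4) with hκ'def
  have hκκ' : κ ≤ κ' := le_max_left _ _
  have hκ'0 : 0 < κ' := lt_of_lt_of_le (by norm_num) (le_max_right _ _)
  have hκ'1 : κ' < 1 / 2 := max_lt hκ (by norm_num)
  have hκ'one : κ' < 1 := by linarith
  set α : ℝ := -Real.log (1 - κ') with hαdef
  set β : ℝ := -Real.log κ' with hβdef
  have hα : 0 < α := by
    have : Real.log (1 - κ') < 0 := Real.log_neg (by linarith) (by linarith)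
    simp only [hαdef]; linarith
  have hαβ : α < β := by
    have : Real.log κ' < Real.log (1 - κ') := Real.log_lt_log hκ'0 (by linarith)
    simp only [hαdef, hβdef]; linarith
  -- the modulus `5^j > 30 K`, `j ≥ 1`
  obtain ⟨n₀, hn₀⟩ := exists_nat_gt (30 * K)
  set j : ℕ := n₀ + 1 with hjdef
  have hj5 : 30 * K < ((5 ^ j : ℕ) : ℝ) := by
    have h1 : n₀ < 5 ^ j := by
      calc n₀ < 5 ^ n₀ := Nat.lt_pow_self (by norm_num)
        _ ≤ 5 ^ j := Nat.pow_le_pow_right (by norm_num) (Nat.le_succ _)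
    have h2 : (n₀ : ℝ) < ((5 ^ j : ℕ) : ℝ) := by exact_mod_cast h1
    linarith
  set M : ℕ := 5 ^ j with hMdef
  have hM0 : 0 < M := pow_pos (by norm_num) j
  set N : ℕ := Nat.totient M with hNdef
  have hN0 : 0 < N := Nat.totient_pos.mpr hM0
  have hNR : (0 : ℝ) < N := by exact_mod_cast hN0
  -- Dirichlet
  obtain ⟨k, m, hk, _hm, hθ0, hθ⟩ :=
    exists_pos_nat_abs_log_two_three_le (δ := (β - α) / N) (div_pos (by linarith) hNR)
  set θ : ℝ := |(k : ℝ) * Real.log 2 - (m : ℝ) * Real.log 3| with hθdef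
  -- the multiple `t`
  set t : ℕ := ⌈α / (N * θ)⌉₊ with htdef
  have hNθ : 0 < (N : ℝ) * θ := mul_pos hNR hθ0
  have ht1 : α / (N * θ) ≤ t := Nat.le_ceil _
  have ht2 : (t : ℝ) < α / (N * θ) + 1 := Nat.ceil_lt_add_one (div_pos hα hNθ).le
  have ht0 : 0 < t := by
    have : (0 : ℝ) < t := lt_of_lt_of_le (div_pos hα hNθ) ht1
    exact_mod_cast this
  have hlow : α ≤ (t : ℝ) * (N * θ) := by rwa [div_le_iff₀ hNθ] at ht1
  have hupp : (t : ℝ) * (N * θ) < β := by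
    have h1 : (t : ℝ) * (N * θ) < (α / (N * θ) + 1) * (N * θ) := mul_lt_mul_of_pos_right ht2 hNθ
    rw [add_mul, div_mul_cancel₀ _ hNθ.ne', one_mul] at h1
    have h2 : (N : ℝ) * θ ≤ β - α := by rwa [le_div_iff₀' hNR] at hθ
    linarith
  -- the powers `X = 2^(k N t)`, `Y = 3^(m N t)`
  set e : ℕ := N * t with hedef
  set X : ℕ := 2 ^ (k * e) with hXdef
  set Y : ℕ := 3 ^ (m * e) with hYdef
  have hX0 : 0 < X := pow_pos (by norm_num) _
  have hY0 : 0 < Y := pow_pos (by norm_num) _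
  have hXR : (0 : ℝ) < (X : ℝ) := by exact_mod_cast hX0
  have hYR : (0 : ℝ) < (Y : ℝ) := by exact_mod_cast hY0
  have hlogX : Real.log (X : ℝ) = (k * e : ℕ) * Real.log 2 := by
    rw [hXdef]; push_cast; rw [Real.log_pow]; push_cast; ring
  have hlogY : Real.log (Y : ℝ) = (m * e : ℕ) * Real.log 3 := by
    rw [hYdef]; push_cast; rw [Real.log_pow]; push_cast; ring
  have hD : Real.log (Y : ℝ) - Real.log (X : ℝ) =
      (e : ℝ) * ((m : ℝ) * Real.log 3 - (k : ℝ) * Real.log 2) := by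
    rw [hlogX, hlogY]; push_cast; ring
  have heR : (e : ℝ) = (t : ℝ) * N := by rw [hedef]; push_cast; ring
  have habsD : |Real.log (Y : ℝ) - Real.log (X : ℝ)| = (t : ℝ) * (N * θ) := by
    rw [hD, abs_mul, abs_of_nonneg (Nat.cast_nonneg e), heR, hθdef, abs_sub_comm]; ring
  -- congruences `X ≡ 1`, `Y ≡ 1 (mod 5^j)`
  have h2M : X ≡ 1 [MOD M] := by
    have hc : Nat.Coprime 2 M := by
      rw [hMdef]; exact (Nat.coprime_primes Nat.prime_two (by norm_num)).mpr (by norm_num) |>.pow_right j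
    have h := (Nat.ModEq.pow_totient hc).pow (k * t)
    rw [one_pow, ← pow_mul] at h
    have : N * (k * t) = k * e := by rw [hedef]; ring
    rwa [← hNdef, this] at h
  have h3M : Y ≡ 1 [MOD M] := by
    have hc : Nat.Coprime 3 M := by
      rw [hMdef]; exact (Nat.coprime_primes Nat.prime_three (by norm_num)).mpr (by norm_num) |>.pow_right j
    have h := (Nat.ModEq.pow_totient hc).pow (m * t)
    rw [one_pow, ← pow_mul] at h
    have : N * (m * t) = m * e := by rw [hedef]; ring
    rwa [← hNdef, this] at h
  -- case distinction on which power is larger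
  rcases lt_or_ge X Y with hXY | hYX
  · -- `a = X = 2^…`, `c = Y = 3^…`
    have hdvd : 5 ^ j ∣ 3 ^ (m * e) - 2 ^ (k * e) :=
      (Nat.modEq_iff_dvd' hXY.le).mp (h2M.trans h3M.symm)
    obtain ⟨hT, hrad⟩ := balancedWitness_core Nat.prime_two Nat.prime_three (by norm_num : (5 : ℕ).Prime)
      (by norm_num) hXY hdvd
    have hpos : 0 < Real.log (Y : ℝ) - Real.log (X : ℝ) := by
      have := Real.log_lt_log hXR (by exact_mod_cast hXY : (X : ℝ) < Y); linarith
    have hDeq : Real.log (Y : ℝ) - Real.log (X : ℝ) = (t : ℝ) * (N * θ) := by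
      rw [← habsD, abs_of_pos hpos]
    obtain ⟨hbal1, hbal2⟩ := balanced_of_log_bounds hκ'0 hκ'one hXR hYR
      (by rw [hDeq]; exact hlow) (by rw [hDeq]; exact hupp.le)
    refine ⟨X, Y - X, Y, hT, ?_, ?_, ?_⟩
    · exact (mul_le_mul_of_nonneg_right hκκ' hYR.le).trans hbal1
    · rw [Nat.cast_sub hXY.le]
      exact (mul_le_mul_of_nonneg_right hκκ' hYR.le).trans hbal2
    · have hrad' : rad X (Y - X) Y * 5 ^ j ≤ 30 * (Y - X) := by norm_num at hrad; exact hrad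
      have hradR : ((rad X (Y - X) Y : ℕ) : ℝ) * ((5 ^ j : ℕ) : ℝ) ≤ 30 * ((Y - X : ℕ) : ℝ) := by
        exact_mod_cast hrad'
      have hbc : ((Y - X : ℕ) : ℝ) < (Y : ℝ) := by exact_mod_cast Nat.sub_lt hY0 hX0
      exact final_bound hj5 (by positivity) hYR hbc (Nat.cast_nonneg _) hradR
  · -- `a = Y = 3^…`, `c = X = 2^…`
    have hne : X ≠ Y := by
      intro h
      have : |Real.log (Y : ℝ) - Real.log (X : ℝ)| = 0 := by rw [h, sub_self, abs_zero]
      rw [habsD] at this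
      linarith
    have hYX' : Y < X := lt_of_le_of_ne hYX (Ne.symm hne)
    have hdvd : 5 ^ j ∣ 2 ^ (k * e) - 3 ^ (m * e) :=
      (Nat.modEq_iff_dvd' hYX'.le).mp (h3M.trans h2M.symm)
    obtain ⟨hT, hrad⟩ := balancedWitness_core Nat.prime_three Nat.prime_two (by norm_num : (5 : ℕ).Prime)
      (by norm_num) hYX' hdvd
    have hpos : 0 < Real.log (X : ℝ) - Real.log (Y : ℝ) := by
      have := Real.log_lt_log hYR (by exact_mod_cast hYX' : (Y : ℝ) < X); linarith
    have hDeq : Real.log (X : ℝ) - Real.log (Y : ℝ) = (t : ℝ) * (N * θ) := by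
      rw [← habsD, abs_sub_comm, abs_of_pos hpos]
    obtain ⟨hbal1, hbal2⟩ := balanced_of_log_bounds hκ'0 hκ'one hYR hXR
      (by rw [hDeq]; exact hlow) (by rw [hDeq]; exact hupp.le)
    refine ⟨Y, X - Y, X, hT, ?_, ?_, ?_⟩
    · exact (mul_le_mul_of_nonneg_right hκκ' hXR.le).trans hbal1
    · rw [Nat.cast_sub hYX'.le]
      exact (mul_le_mul_of_nonneg_right hκκ' hXR.le).trans hbal2
    · have hrad' : rad Y (X - Y) X * 5 ^ j ≤ 30 * (X - Y) := by norm_num at hrad; exact hrad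
      have hradR : ((rad Y (X - Y) X : ℕ) : ℝ) * ((5 ^ j : ℕ) : ℝ) ≤ 30 * ((X - Y : ℕ) : ℝ) := by
        exact_mod_cast hrad'
      have hbc : ((X - Y : ℕ) : ℝ) < (X : ℝ) := by exact_mod_cast Nat.sub_lt hX0 hY0
      exact final_bound hj5 (by positivity) hXR hbc (Nat.cast_nonneg _) hradR
where
  /-- The final real inequality: `rad · F ≤ 30 b`, `b < c`, `30K < F`, `F > 0` give `K · rad < c`. -/
  final_bound {K F rd b c : ℝ} (hKF : 30 * K < F) (hF : 0 < F) (hc : 0 < c) (hbc : b < c)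
      (hrd : 0 ≤ rd) (hrad : rd * F ≤ 30 * b) : K * rd < c := by
    rcases le_or_gt K 0 with hK | hK
    · exact lt_of_le_of_lt (mul_nonpos_of_nonpos_of_nonneg hK hrd) hc
    · have h1 : K * rd * F ≤ 30 * K * b := by
        have := mul_le_mul_of_nonneg_left hrad hK.le
        linarith [this]
      have h2 : 30 * K * b < 30 * K * c := mul_lt_mul_of_pos_left hbc (by positivity)
      have h3 : 30 * K * c < F * c := mul_lt_mul_of_pos_right hKF hc
      have h4 : K * rd * F < c * F := by linarith [mul_comm F c]
      exact lt_of_mul_lt_mul_right h4 hF.le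

/-- **The `ε = 0` Szpiro bound fails on every balance window.** For `0 < κ < 1/2` there is no `C` with
`(abc)² ≤ C · rad(abc)^6` for all abc triples with `κc ≤ a`, `κc ≤ b`: on the window
`(abc)² ≥ κ⁴c⁶` (`balanced_pow_six_le`) while `c/rad(abc)` is unbounded
(`exists_balanced_abc_triple_lt`). [new] -/
theorem not_balancedSzpiro_epsilon_zero {κ : ℝ} (hκ0 : 0 < κ) (hκ : κ < 1 / 2) :
    ¬ ∃ C : ℝ, ∀ a b c : ℕ, IsABCTriple a b c → κ * (c : ℝ) ≤ (a : ℝ) → κ * (c : ℝ) ≤ (b : ℝ) →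
      ((a * b * c : ℕ) : ℝ) ^ 2 ≤ C * ((rad a b c : ℕ) : ℝ) ^ (6 : ℝ) := by
  rintro ⟨C, hC⟩
  set K : ℝ := max C 0 / κ ^ 4 + 1 with hKdef
  have hκ4 : 0 < κ ^ 4 := by positivity
  have hK1 : 1 ≤ K := by
    have : 0 ≤ max C 0 / κ ^ 4 := div_nonneg (le_max_right _ _) hκ4.le
    linarith
  have hK0 : 0 < K := by linarith
  obtain ⟨a, b, c, hT, ha, hb, hlt⟩ := exists_balanced_abc_triple_lt κ K hκ
  have key := hC a b c hT ha hb
  have hlow : κ ^ 4 * (c : ℝ) ^ 6 ≤ ((a * b * c : ℕ) : ℝ) ^ 2 := balanced_pow_six_le hκ0.le ha hb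
  set R : ℝ := ((rad a b c : ℕ) : ℝ) with hRdef
  have hR1 : (1 : ℝ) ≤ R := by
    rw [hRdef]; exact_mod_cast Nat.one_le_iff_ne_zero.mpr (Nat.radical_pos _).ne'
  have hR0 : (0 : ℝ) < R := by linarith
  have hrpow : R ^ (6 : ℝ) = R ^ (6 : ℕ) := by exact_mod_cast Real.rpow_natCast R 6
  rw [hrpow] at key
  -- `c > K R ≥ 0`, so `c⁶ > K⁶ R⁶ ≥ K R⁶` and `κ⁴ c⁶ > κ⁴ K R⁶ ≥ max C 0 · R⁶ ≥ C R⁶`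
  have hKR : 0 ≤ K * R := by positivity
  have hc6 : (K * R) ^ 6 < (c : ℝ) ^ 6 := pow_lt_pow_left₀ hlt hKR (by norm_num)
  have hK6 : K * R ^ 6 ≤ (K * R) ^ 6 := by
    rw [mul_pow]
    have : K ≤ K ^ 6 := by
      calc K = K ^ 1 := (pow_one K).symm
        _ ≤ K ^ 6 := pow_le_pow_right₀ hK1 (by norm_num)
    exact mul_le_mul_of_nonneg_right this (by positivity)
  have hCK : max C 0 < κ ^ 4 * K := by
    rw [hKdef, mul_add, mul_div_cancel₀ _ hκ4.ne', mul_one]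
    linarith
  have hR6 : 0 < R ^ 6 := by positivity
  have h1 : C * R ^ 6 ≤ max C 0 * R ^ 6 := mul_le_mul_of_nonneg_right (le_max_left _ _) hR6.le
  have h2 : max C 0 * R ^ 6 < κ ^ 4 * K * R ^ 6 := mul_lt_mul_of_pos_right hCK hR6
  have h3 : κ ^ 4 * K * R ^ 6 ≤ κ ^ 4 * (K * R) ^ 6 := by
    rw [mul_assoc]; exact mul_le_mul_of_nonneg_left hK6 hκ4.le
  have h4 : κ ^ 4 * (K * R) ^ 6 < κ ^ 4 * (c : ℝ) ^ 6 := mul_lt_mul_of_pos_left hc6 hκ4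
  linarith

/-- **The crux with `ε := 0` is false** (`BalancedFreySzpiro_false_without_eps` shape): the statement
obtained from `BalancedFreySzpiro` by replacing `6 + ε` with `6 + 0` (and dropping `0 < ε`) fails —
take `κ = 1/4`. So the `ε` of the crux is needed on the compactly balanced cell too, and any line whose
method loses only a constant factor on the cell aims at a false statement. [new] -/
theorem balancedFreySzpiro_false_without_eps :
    ¬ ∀ κ : ℝ, 0 < κ → ∃ C : ℝ, ∀ a b c : ℕ, IsABCTriple a b c → κ * (c : ℝ) ≤ (a : ℝ) →
      κ * (c : ℝ) ≤ (b : ℝ) → ((a * b * c : ℕ) : ℝ) ^ 2 ≤ C * ((rad a b c : ℕ) : ℝ) ^ ((6 : ℝ) + 0) := by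
  intro h
  have h14 := h (1 / 4) (by norm_num)
  simp only [add_zero] at h14
  exact not_balancedSzpiro_epsilon_zero (κ := 1 / 4) (by norm_num) (by norm_num) h14

end Summit.ABC.ABC.Theorems.BalancedFreySzpiro.Negative

end
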